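import Mathlib.Analysis.InnerProductSpace.PiL2
import Literature.Analysis.UnboundedOperators.FourierSpectrum
import Literature.MathematicalPhysics.QuantumFieldTheory.ConstructiveQFTWave0
import HarnessLib

-- provenance: harness21/H21/H21/Statements/ConstructiveQFT/MassGap.lean @ 42d0886 (interim HEAD d8f2665); M5 mechanical rewrite
/-!
# The mass gap of a Wightman theory (family `constructive-qft`, trunk G07 UnbddOp, item S-A)

`constructive-qft.S09` (definition; Jaffe–Witten, *Quantum Yang–Mills theory*, Clay problem
description (2000), p. 6; Streater–Wightman, *PCT, Spin and Statistics, and All That* (1964),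
§3.1): the time translations `U(t, 0⃗) = e^{itH}` of a relativistic quantum theory with vacuum `Ω`
have a *mass gap* `Δ > 0` if `H ≥ 0`, `H Ω = 0`, `0` is a simple eigenvalue of `H` and
`σ(H) ∖ {0} ⊆ [Δ, ∞)`.

Two encodings of this definition coexist in H21:

* the **unbundled** one of wave 0, `Literature.ConstructiveQFT.HasMassGap (U : ℝ → E →L[ℂ] E) Ω Δ`
  (`Literature.Statements.ConstructiveQFT.Wave0`), phrased for a bare curve of operators together with
  `ConstructiveQFT.IsUnitaryGroup` and `ConstructiveQFT.IsGenerator`;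
* the **bundled** one of this file, `Literature.UnitaryRep.HasMassGap (U : OneParameterUnitaryGroup H)
  Ω Δ := U.IsVacuum Ω ∧ U.hamiltonian.HasGroundStateGap Ω Δ`, built on the G07 prelude
  (`UnitaryRep`, `UnitaryRep.hamiltonian`, `LinearPMap.HasGroundStateGap`).

The bundled encoding is **canonical for later waves** (the Wightman layer of G13 consumes
`UnitaryRep`); the bridge `UnitaryRep.hasMassGap_iff` keeps the two honest and carries the
inventory id. The three bridge statements concern the curve `U.appReal : ℝ → H →L[ℂ] H`:
`isUnitaryGroup_appReal` (proved), `isGenerator_appReal_hamiltonian` (Stone's theorem: wave 0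
uses the two-sided difference quotient on `𝓝[≠] 0` with limit `i H ψ`, the prelude uses the
right derivative of the forward semigroup and `H = -i A`; proved here from the prelude lemmas
`OneParameterGroup.mem_generator_domain_iff_two_sided` / `tendsto_generator_two_sided`, which are
themselves `sorry`-ed in the prelude), and `hasMassGap_iff` (`sorry`: needs uniqueness of the
Stone generator). Only `hasMassGap_iff` carries the inventory id in bold.

For space-time translation groups `U : ℝ^{1+d} → 𝒰(H)` we single out the time translations
`U.timeTranslations := U.alongDirection e₀` and the predicate `HasMassGapWithUniqueVacuum`
(unique translation-invariant vacuum + mass gap of the time translations), the shape in which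
the Wightman layer will consume S09. The sanity lemma `hasMassGap_iff_hasFourierSpectrumIn`
restates the gap through the spectral condition of item C5 (`{0} ∪ [Δ, ∞)` in physical units, no
`2π`).

**Not asserted here.** The transfer-matrix half of `constructive-qft.S10` (Euclidean clustering
⇔ Hamiltonian gap for `T = e^{-H}`) needs the functional calculus `H ↦ e^{-H}` and the
statistical-mechanics transfer matrix (G02/G13); its operator-theoretic vocabulary is
`ContinuousLinearMap.HasTransferGap` / `ContinuousLinearMap.hasTransferGap_iff_spectrum` of the
prelude item C2 (`Literature.Prelude.UnbddOp.SpectralGap`), to which G13 should bridge.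

## Mathlib

Mathlib (pinned) has `unitary (H →L[ℂ] H)`, `EuclideanSpace`, `EuclideanSpace.single`,
`LinearPMap` with `IsSelfAdjoint`, filters `𝓝[≠] 0`; it has no unitary representations, no Stone
theorem, no spectral gap / mass gap vocabulary (searched `massGap`, `spectralGap`, `Stone`,
`groundState`). Everything below is a thin layer over the accepted G07 prelude and wave 0.

## Design choices

* `UnitaryRep.HasMassGap` is stated for `OneParameterUnitaryGroup H = UnitaryRep
  (Multiplicative ℝ) H` in the `UnitaryRep` namespace, so that dot notation `U.HasMassGap Ω Δ`
  works for both one-parameter groups and `U.timeTranslations`.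
* No normalisation `‖Ω‖ = 1` (as in `UnitaryRep.IsVacuum` and in wave 0), which makes
  `hasMassGap_iff` an `↔`.
* Time is the coordinate `0` of `EuclideanSpace ℝ (Fin (d + 1))`, matching wave 0's lattice
  convention (`Site.timeReflect`) and the forward-cone remark of item C5.
-/

noncomputable section

open Filter Topology
open scoped InnerProductSpace

namespace Literature.MathematicalPhysics.QuantumFieldTheory

section UnitaryRep
open Literature.Analysis.UnboundedOperators (UnitaryRep)
open Literature.Analysis.UnboundedOperators.UnitaryRep

variable {H : Type*} [NormedAddCommGroup H] [InnerProductSpace ℂ H] [CompleteSpace H]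

/-! ### The bundled mass gap -/

/-- The one-parameter unitary group `U(t) = e^{itH}` with vacuum `Ω` has *mass gap* `Δ`:
`Ω` is a vacuum vector of `U` (invariant and non-zero) and the Hamiltonian `H = U.hamiltonian`
is self-adjoint, positive, annihilates `Ω`, and satisfies `Δ ‖ψ‖² ≤ re ⟪ψ, H ψ⟫` for
`ψ ∈ dom H ∩ {Ω}ᗮ` with `0 < Δ` — the variational form of "`H ≥ 0`, `H Ω = 0`, `0` is a simple
eigenvalue and `σ(H) ∖ {0} ⊆ [Δ, ∞)`" (Jaffe–Witten (2000), p. 6; Streater–Wightman (1964),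
§3.1; min–max: Reed–Simon IV, Thm. XIII.1). This bundled encoding is the canonical one for
later waves; see `hasMassGap_iff` for the bridge to wave 0. [cite: JaffeWitten2000] -/
def _root_.Literature.Analysis.UnboundedOperators.UnitaryRep.HasMassGap (U : Literature.Analysis.UnboundedOperators.OneParameterUnitaryGroup H) (Ω : H) (Δ : ℝ) : Prop :=
  U.IsVacuum Ω ∧ U.hamiltonian.HasGroundStateGap Ω Δ

/-- A mass gap entails positivity of the energy, `H ≥ 0` (Streater–Wightman (1964), §3.1,
spectral condition). [cite: StreaterWightman1964] -/
theorem _root_.Literature.Analysis.UnboundedOperators.UnitaryRep.HasMassGap.hasPositiveEnergy {U : Literature.Analysis.UnboundedOperators.OneParameterUnitaryGroup H} {Ω : H} {Δ : ℝ}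
    (h : U.HasMassGap Ω Δ) : U.HasPositiveEnergy :=
  h.2.hasFormGap.1

/-- Under a mass gap, `Ω` is a vacuum vector of `U` (Streater–Wightman (1964), §3.1). [cite: StreaterWightman1964] -/
theorem _root_.Literature.Analysis.UnboundedOperators.UnitaryRep.HasMassGap.isVacuum {U : Literature.Analysis.UnboundedOperators.OneParameterUnitaryGroup H} {Ω : H} {Δ : ℝ}
    (h : U.HasMassGap Ω Δ) : U.IsVacuum Ω :=
  h.1

/-- A mass gap is positive: `0 < Δ` (Jaffe–Witten (2000), p. 6). [cite: JaffeWitten2000] -/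
theorem _root_.Literature.Analysis.UnboundedOperators.UnitaryRep.HasMassGap.pos {U : Literature.Analysis.UnboundedOperators.OneParameterUnitaryGroup H} {Ω : H} {Δ : ℝ}
    (h : U.HasMassGap Ω Δ) : 0 < Δ :=
  h.2.hasFormGap.2.2.2.1

/-- A mass gap `Δ` may be weakened to any `0 < Δ' ≤ Δ` (monotonicity of
`σ(H) ∖ {0} ⊆ [Δ, ∞)` in `Δ`). [folklore] -/
theorem _root_.Literature.Analysis.UnboundedOperators.UnitaryRep.HasMassGap.anti {U : Literature.Analysis.UnboundedOperators.OneParameterUnitaryGroup H} {Ω : H} {Δ Δ' : ℝ}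
    (h : U.HasMassGap Ω Δ) (hΔ' : 0 < Δ') (hle : Δ' ≤ Δ) : U.HasMassGap Ω Δ' :=
  ⟨h.1, h.2.1, h.2.hasFormGap.anti hΔ' hle⟩

/-- Under a mass gap the vacuum is unique: the invariant vectors of `U` are exactly `ℂ ∙ Ω`
(the kernel of `H` is `ℂ ∙ Ω` by `LinearPMap.HasFormGap.kernel_eq_span`, and invariant vectors
lie in the kernel; Streater–Wightman (1964), §3.1, uniqueness of the vacuum). [cite: StreaterWightman1964] -/
def _root_.Literature.Analysis.UnboundedOperators.UnitaryRep.HasMassGap.hasUniqueVacuum : Prop :=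
  ∀ {U : Literature.Analysis.UnboundedOperators.OneParameterUnitaryGroup H} {Ω : H} {Δ : ℝ} (h : U.HasMassGap Ω Δ),
    U.HasUniqueVacuum Ω

/- interim proof relied on results that are now named facts (D-0014); demoted to a fact by the M5 import, proof preserved:
:= by
  refine ⟨h.1, le_antisymm ?_ ?_⟩
  · rw [← h.2.hasFormGap.kernel_eq_span]
    exact U.invariantVectors_le_kernel_hamiltonian
  · rw [Submodule.span_le, Set.singleton_subset_iff]
    exact h.1.1
-/

/-- Spectral form of the mass gap: `U(t) = e^{itH}` has mass gap `Δ` with vacuum `Ω` iff `Ω` is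
the unique vacuum of `U`, `0 < Δ`, and the Fourier spectrum of `U` (the support of the spectral
measure of `H`, in physical units — no `2π`) lies in `{0} ∪ [Δ, ∞)` (Stone's theorem and the
spectral theorem, Reed–Simon I, §VIII.3–4; min–max, Reed–Simon IV, Thm. XIII.1;
Streater–Wightman (1964), §3.1). Immediate from the prelude lemma
`UnitaryRep.hasGroundStateGap_hamiltonian_iff`. [cite: StreaterWightman1964] -/
def _root_.Literature.Analysis.UnboundedOperators.UnitaryRep.hasMassGap_iff_hasFourierSpectrumIn : Prop :=
  ∀ (U : Literature.Analysis.UnboundedOperators.OneParameterUnitaryGroup H) (Ω : H) (Δ : ℝ),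
    U.HasMassGap Ω Δ ↔
      U.HasUniqueVacuum Ω ∧ 0 < Δ ∧ U.HasFourierSpectrumIn ({0} ∪ Set.Ici Δ)

/- interim proof relied on results that are now named facts (D-0014); demoted to a fact by the M5 import, proof preserved:
:= by
  rw [HasMassGap, hasGroundStateGap_hamiltonian_iff]
  exact ⟨fun h => h.2, fun h => ⟨h.1.1, h⟩⟩
-/

/-! ### Bridges to the unbundled encoding of wave 0 -/

/-- The curve `t ↦ U(t)` of a bundled one-parameter unitary group is a strongly continuous
one-parameter unitary group in the unbundled sense of wave 0
(`ConstructiveQFT.IsUnitaryGroup`; Streater–Wightman (1964), §3.1). [cite: StreaterWightman1964] -/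
theorem _root_.Literature.Analysis.UnboundedOperators.UnitaryRep.isUnitaryGroup_appReal (U : Literature.Analysis.UnboundedOperators.OneParameterUnitaryGroup H) :
    QuantumFieldTheory.IsUnitaryGroup U.appReal where
  apply_zero := U.appReal_zero
  apply_add := U.appReal_add
  mem_unitary := U.appReal_mem_unitary
  continuous_apply := U.continuous_appReal_apply

/-- **Stone's theorem, bridge form.** The Hamiltonian `U.hamiltonian = -i A` of the prelude
(`A` the generator of the forward semigroup, right difference quotients) is a generator of the
curve `U.appReal` in the sense of wave 0 (`ConstructiveQFT.IsGenerator`: two-sided difference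
quotients on `𝓝[≠] 0` with limit `i H ψ`). The proof reduces to the prelude lemmas
`OneParameterGroup.mem_generator_domain_iff_two_sided` and
`OneParameterGroup.tendsto_generator_two_sided` (Engel–Nagel (2000), §II.3.11; Reed–Simon I,
Thm. VIII.7). [cite: EngelNagel2000] -/
def _root_.Literature.Analysis.UnboundedOperators.UnitaryRep.isGenerator_appReal_hamiltonian : Prop :=
  ∀ (U : Literature.Analysis.UnboundedOperators.OneParameterUnitaryGroup H),
    QuantumFieldTheory.IsGenerator U.appReal U.hamiltonian

/- interim proof relied on results that are now named facts (D-0014); demoted to a fact by the M5 import, proof preserved: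
:= by
  have key : ∀ (ψ : H), (fun t : ℝ => ((t : ℂ)⁻¹) • (U.appReal t ψ - ψ)) =
      fun t : ℝ => ((t⁻¹ : ℝ) : ℂ) •
        (OneParameterGroup.app U.toStrongContRepresentation t ψ - ψ) := by
    intro ψ
    funext t
    rw [Complex.ofReal_inv, app_toStrongContRepresentation]
  refine ⟨fun ψ => ?_, fun ψ => ?_⟩
  · rw [hamiltonian_domain, OneParameterGroup.mem_generator_domain_iff_two_sided, key]
    exact Iff.rfl
  · have hI : Complex.I * -Complex.I = 1 := by rw [mul_neg, Complex.I_mul_I, neg_neg]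
    rw [key, hamiltonian_apply, smul_smul, hI, one_smul]
    exact OneParameterGroup.tendsto_generator_two_sided U.toStrongContRepresentation ψ
-/

/-- **constructive-qft.S09** (mass gap of a Wightman theory; Jaffe–Witten (2000), p. 6;
Streater–Wightman (1964), §3.1). *Definition:* the generator `H ≥ 0` of the time translations
`U(t, 0⃗) = e^{itH}` satisfies `H Ω = 0`, `0` is a simple eigenvalue and
`σ(H) ∖ {0} ⊆ [Δ, ∞)` for some `Δ > 0` (the *mass gap*). H21 has two encodings of this
definition: the unbundled `ConstructiveQFT.HasMassGap (U : ℝ → E →L[ℂ] E) Ω Δ` of wave 0 (bare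
operator curve, existentially quantified self-adjoint generator, gap in variational form on
`dom H ∩ {Ω}ᗮ`) and the bundled `UnitaryRep.HasMassGap` of this file (Stone Hamiltonian of a
`OneParameterUnitaryGroup`, `LinearPMap.HasGroundStateGap`). This theorem states that they agree
on `U.appReal`; the **bundled encoding `UnitaryRep.HasMassGap` is canonical for later waves**.
Proof sketch: `→` takes `H := U.hamiltonian` (`isSelfAdjoint_hamiltonian`,
`isGenerator_appReal_hamiltonian`); `←` uses that a generator in the sense of `IsGenerator` is
uniquely determined by `U` and equals `U.hamiltonian`, and that `H Ω = 0` for a generator forces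
`U(t) Ω = Ω` (Reed–Simon I, Thm. VIII.7–VIII.8). [cite: JaffeWitten2000] -/
def _root_.Literature.Analysis.UnboundedOperators.UnitaryRep.hasMassGap_iff : Prop :=
  ∀ (U : Literature.Analysis.UnboundedOperators.OneParameterUnitaryGroup H) (Ω : H) (Δ : ℝ),
    U.HasMassGap Ω Δ ↔ QuantumFieldTheory.HasMassGap U.appReal Ω Δ

/-! ### Time translations of a space-time translation group -/

/-- The *time translations* `t ↦ U(t e₀)` of a unitary representation of the space-time
translation group `ℝ^{1+d}` (time = coordinate `0`, `e₀ = EuclideanSpace.single 0 1`), as a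
one-parameter unitary group; its Hamiltonian is the energy operator `H = P⁰`
(Streater–Wightman (1964), §3.1; Jaffe–Witten (2000), p. 6, `U(t, 0⃗) = e^{itH}`). [cite: StreaterWightman1964] -/
def _root_.Literature.Analysis.UnboundedOperators.UnitaryRep.timeTranslations {d : ℕ} (U : UnitaryRep (Multiplicative (EuclideanSpace ℝ (Fin (d + 1)))) H) :
    Literature.Analysis.UnboundedOperators.OneParameterUnitaryGroup H :=
  U.alongDirection (EuclideanSpace.single 0 1)

/-- `U.timeTranslations (ofAdd t) = U (ofAdd (t • e₀))` (Streater–Wightman (1964), §3.1). [cite: StreaterWightman1964] -/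
@[simp]
theorem _root_.Literature.Analysis.UnboundedOperators.UnitaryRep.timeTranslations_apply {d : ℕ}
    (U : UnitaryRep (Multiplicative (EuclideanSpace ℝ (Fin (d + 1)))) H) (t : ℝ) :
    U.timeTranslations (Multiplicative.ofAdd t) =
      U (Multiplicative.ofAdd (t • EuclideanSpace.single (0 : Fin (d + 1)) (1 : ℝ))) :=
  rfl

/-- The Hamiltonian of the time translations is the momentum operator in the time direction,
`H = P_{e₀}` (by definition of `UnitaryRep.momentum`; Streater–Wightman (1964), §3.1). [cite: StreaterWightman1964] -/
@[simp]
theorem _root_.Literature.Analysis.UnboundedOperators.UnitaryRep.hamiltonian_timeTranslations {d : ℕ}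
    (U : UnitaryRep (Multiplicative (EuclideanSpace ℝ (Fin (d + 1)))) H) :
    U.timeTranslations.hamiltonian = U.momentum (EuclideanSpace.single 0 1) :=
  rfl

/-- *Mass gap with unique vacuum* for a unitary representation `U` of the space-time translation
group `ℝ^{1+d}`: `Ω` is the unique translation-invariant vector (up to scalars) and the time
translations `U(t e₀) = e^{itH}` have mass gap `Δ` with vacuum `Ω`. This is the shape in which
the Wightman axioms (G13) consume S09 (Streater–Wightman (1964), §3.1, uniqueness of the vacuum
and spectral condition; Jaffe–Witten (2000), p. 6). [cite: StreaterWightman1964] -/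
def _root_.Literature.Analysis.UnboundedOperators.UnitaryRep.HasMassGapWithUniqueVacuum {d : ℕ}
    (U : UnitaryRep (Multiplicative (EuclideanSpace ℝ (Fin (d + 1)))) H) (Ω : H) (Δ : ℝ) :
    Prop :=
  U.HasUniqueVacuum Ω ∧ U.timeTranslations.HasMassGap Ω Δ

/-- A mass gap with unique vacuum yields, in particular, a mass gap of the time translations
(by definition). [folklore] -/
theorem _root_.Literature.Analysis.UnboundedOperators.UnitaryRep.HasMassGapWithUniqueVacuum.hasMassGap {d : ℕ}
    {U : UnitaryRep (Multiplicative (EuclideanSpace ℝ (Fin (d + 1)))) H} {Ω : H} {Δ : ℝ}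
    (h : U.HasMassGapWithUniqueVacuum Ω Δ) : U.timeTranslations.HasMassGap Ω Δ :=
  h.2

/-- A mass gap with unique vacuum may be weakened to any `0 < Δ' ≤ Δ`. [folklore] -/
theorem _root_.Literature.Analysis.UnboundedOperators.UnitaryRep.HasMassGapWithUniqueVacuum.anti {d : ℕ}
    {U : UnitaryRep (Multiplicative (EuclideanSpace ℝ (Fin (d + 1)))) H} {Ω : H} {Δ Δ' : ℝ}
    (h : U.HasMassGapWithUniqueVacuum Ω Δ) (hΔ' : 0 < Δ') (hle : Δ' ≤ Δ) :
    U.HasMassGapWithUniqueVacuum Ω Δ' :=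
  ⟨h.1, h.2.anti hΔ' hle⟩

end UnitaryRep

end Literature.MathematicalPhysics.QuantumFieldTheory
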